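import Literature.Algebra.Polynomial.BellTouchardPolynomials
import Mathlib.Combinatorics.Enumerative.Stirling
import Mathlib.Tactic
import HarnessLib

/-!
# The exponential (Touchard) polynomials: Stirling connection constants, Rodrigues' formula
# `φ_n (x) = e^{−x} (xD)^n e^x` and Dobiński's formula (Rota–Kahaner–Odlyzko §14)

G.-C. Rota, D. Kahaner, A. Odlyzko, *Finite operator calculus* (1973), §14, "Exponential
polynomials", pp. 747–748:

> Also of statistical origin are the exponential polynomials `φ_n (x)`, introduced by Steffensen and
> studied further by Touchard and others. … We recall that they are the basic polynomials for the
> delta operator `log (I + D)`, and that they are inverse to `(x)_n`, so that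
> `φ_n (x (x − 1) ⋯ (x − n + 1)) = x^n` [umbrally], and `φ_n (x) = Σ_{k ≥ 0} S(n, k) x^k`, where,
> following Riordan's notation, the `S(n, k)` denote the Stirling numbers of the second kind …
> Also, the Rodrigues formula ((4) of Theorem 4) says that `φ_{n+1} (x) = x (φ_n (x) + φ_n' (x))`.
> The generalized Dobinsky formula … Setting `p (x) = x^n` we obtain finally
> `φ_n (x) = e^{−x} Σ_{k ≥ 0} k^n x^k / k!`. … and Rodrigues' formula … `φ_n (x) = e^{−x} (xD)^n e^x`.

The exponential polynomials are the tree's `touchardPolynomial K n` (Robert's Bell polynomials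
`B_n`, `Literature.Algebra.Polynomial.BellTouchardPolynomials`, with the Rodrigues recurrence
`touchardPolynomial_succ`). Here: their coefficients are Mathlib's `Nat.stirlingSecond`
(`coeff_touchardPolynomial`, `touchardPolynomial_eq_sum_stirlingSecond`); Rodrigues' formula and
Dobiński's formula as identities of formal power series in `x` (`(xD)^n e^x = e^x φ_n (x)`,
`e^x φ_n (x) = Σ_k k^n x^k/k!`). The inverse relation `x^n = Σ_k S(n,k) (x)_k` is the tree's
`Literature.Combinatorics.Enumerative.StirlingSecondFallingFactorials.X_pow_eq_sum_stirlingSecond_descPochhammer`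
and `Nat.bell n = Σ_k S(n,k)` is `Literature.Combinatorics.Enumerative.StirlingSecondKindEGF.bell_eq_sum_stirlingSecond`
(not restated).

## References
* [RotaKahanerOdlyzko1973] G.-C. Rota, D. Kahaner, A. Odlyzko, *On the foundations of
  combinatorial theory VIII. Finite operator calculus*, J. Math. Anal. Appl. 42 (1973) 684–760,
  §14 (Exponential polynomials), pp. 747–748.
* [Robert2000PadicAnalysis] A. M. Robert, *A Course in p-adic Analysis*, GTM 198, Springer (2000),
  Ch. IV §6.3 (the Bell polynomials), pp. 211–212.
-/

noncomputable section

open Polynomial Finset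

namespace Literature.Algebra.Polynomial

variable (K : Type*) [Field K]

/-! ## The Euler operator `xD` on formal power series -/

variable {K} in
/-- `xD` multiplies the `k`-th coefficient by `k`: `[x^k] (x F') = k [x^k] F`.
[cite: RotaKahanerOdlyzko1973, §14 ("`φ_n (x) = e^{−x} (xD)^n e^x`"), p. 748] -/
theorem powerSeries_coeff_X_mul_derivative (F : PowerSeries K) (k : ℕ) :
    PowerSeries.coeff k (PowerSeries.X * PowerSeries.derivative K F) = (k : K) * PowerSeries.coeff k F := by
  cases k with
  | zero => rw [PowerSeries.coeff_zero_X_mul, Nat.cast_zero, zero_mul]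
  | succ k => rw [PowerSeries.coeff_succ_X_mul, PowerSeries.coeff_derivative, mul_comm, Nat.cast_succ]

variable {K} in
/-- `[x^k] (xD)^n F = k^n [x^k] F`. [cite: RotaKahanerOdlyzko1973, §14, p. 748] -/
theorem powerSeries_coeff_iterate_X_mul_derivative (F : PowerSeries K) (n k : ℕ) :
    PowerSeries.coeff k ((fun G => PowerSeries.X * PowerSeries.derivative K G)^[n] F) =
      (k : K) ^ n * PowerSeries.coeff k F := by
  induction n with
  | zero => rw [Function.iterate_zero_apply, pow_zero, one_mul]
  | succ n ih => rw [Function.iterate_succ_apply', powerSeries_coeff_X_mul_derivative, ih, pow_succ', mul_assoc]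

variable [CharZero K]

/-! ## The coefficients of `φ_n` are the Stirling numbers of the second kind -/

/-- **`φ_n (x) = Σ_k S(n,k) x^k`, coefficientwise**: `[x^k] φ_n = S(n,k)` (Mathlib's
`Nat.stirlingSecond`, defined by `S(n+1,k+1) = (k+1) S(n,k+1) + S(n,k)`; the proof is the Rodrigues
recurrence `φ_{n+1} = x (φ_n + φ_n')` read off coefficientwise).
[cite: RotaKahanerOdlyzko1973, §14 ("`φ_n (x) = Σ_{k≥0} S(n,k) x^k`"), p. 747]
[cite: Robert2000PadicAnalysis, Ch. IV §6.3, p. 212] -/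
theorem coeff_touchardPolynomial : ∀ n k : ℕ, (touchardPolynomial K n).coeff k = (n.stirlingSecond k : K)
  | 0, 0 => by rw [touchardPolynomial_zero, coeff_one_zero, Nat.stirlingSecond_zero, Nat.cast_one]
  | 0, k + 1 => by
    rw [touchardPolynomial_zero, coeff_one, if_neg (Nat.succ_ne_zero k), Nat.stirlingSecond_zero_succ,
      Nat.cast_zero]
  | n + 1, 0 => by
    rw [touchardPolynomial_succ, coeff_X_mul_zero, Nat.stirlingSecond_succ_zero, Nat.cast_zero]
  | n + 1, k + 1 => by
    rw [touchardPolynomial_succ, coeff_X_mul, coeff_add, coeff_derivative, coeff_touchardPolynomial n k,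
      coeff_touchardPolynomial n (k + 1), Nat.stirlingSecond_succ_succ]
    push_cast
    ring

/-- **`φ_n (x) = Σ_{k=0}^{n} S(n,k) x^k`.** [cite: RotaKahanerOdlyzko1973, §14, p. 747]
[cite: Robert2000PadicAnalysis, Ch. IV §6.3, p. 212] -/
theorem touchardPolynomial_eq_sum_stirlingSecond (n : ℕ) :
    touchardPolynomial K n = ∑ k ∈ range (n + 1), (n.stirlingSecond k : K) • X ^ k := by
  conv_lhs => rw [(touchardPolynomial K n).as_sum_range_C_mul_X_pow, natDegree_touchardPolynomial]
  refine sum_congr rfl fun k _ => ?_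
  rw [coeff_touchardPolynomial, smul_eq_C_mul]

/-- `S(n, n) = 1`: `φ_n` is monic (consistency with `monic_touchardPolynomial`).
[cite: RotaKahanerOdlyzko1973, §14, p. 747] -/
theorem coeff_touchardPolynomial_self (n : ℕ) : (touchardPolynomial K n).coeff n = 1 := by
  rw [coeff_touchardPolynomial, Nat.stirlingSecond_self, Nat.cast_one]

/-- The Bell numbers as a Stirling row sum, read through `φ_n (1) = B_n`
(`touchardPolynomial_eval_one`): `B_n = Σ_k S(n,k)` in `K`.
[cite: Robert2000PadicAnalysis, Ch. IV §6.3 Comment, p. 212] [cite: RotaKahanerOdlyzko1973, §14, p. 747] -/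
theorem cast_bell_eq_sum_stirlingSecond (n : ℕ) :
    (Nat.bell n : K) = ∑ k ∈ range (n + 1), (n.stirlingSecond k : K) := by
  rw [← touchardPolynomial_eval_one, touchardPolynomial_eq_sum_stirlingSecond, eval_finsetSum]
  refine sum_congr rfl fun k _ => ?_
  rw [eval_smul, eval_pow, eval_X, one_pow, smul_eq_mul, mul_one]

/-! ## Rodrigues' formula `φ_n (x) = e^{−x} (xD)^n e^x` and Dobiński's formula -/

/-- **Rodrigues' formula `φ_n (x) = e^{−x} (xD)^n e^x`**, as the identity of formal power series
`(xD)^n e^x = e^x · φ_n (x)` in `K[[x]]`. [cite: RotaKahanerOdlyzko1973, §14 ("`φ_n (x) = e^{−x}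
(xD)^n e^x`, which shows the roots of these polynomials to be real"), p. 748] -/
theorem iterate_X_mul_derivative_exp (n : ℕ) :
    (fun G => PowerSeries.X * PowerSeries.derivative K G)^[n] (PowerSeries.exp K) =
      PowerSeries.exp K * (touchardPolynomial K n : PowerSeries K) := by
  induction n with
  | zero => rw [Function.iterate_zero_apply, touchardPolynomial_zero, Polynomial.coe_one, mul_one]
  | succ n ih =>
    rw [Function.iterate_succ_apply', ih, Derivation.leibniz, smul_eq_mul, smul_eq_mul,
      PowerSeries.derivative_exp, PowerSeries.derivative_coe, touchardPolynomial_succ, Polynomial.coe_mul,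
      Polynomial.coe_add, Polynomial.coe_X]
    ring

/-- **Dobiński's formula `φ_n (x) = e^{−x} Σ_{k ≥ 0} k^n x^k / k!`**, as the identity of formal power
series `e^x · φ_n (x) = Σ_k (k^n/k!) x^k` in `K[[x]]`.
[cite: RotaKahanerOdlyzko1973, §14 ("the generalized Dobinsky formula … `φ_n (x) = e^{−x} Σ_{k≥0}
k^n x^k/k!`"), pp. 747–748] -/
theorem exp_mul_touchardPolynomial (n : ℕ) :
    PowerSeries.exp K * (touchardPolynomial K n : PowerSeries K) =
      PowerSeries.mk fun k => ((k : K) ^ n) / (k.factorial : K) := by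
  rw [← iterate_X_mul_derivative_exp]
  ext k
  rw [powerSeries_coeff_iterate_X_mul_derivative, PowerSeries.coeff_exp, PowerSeries.coeff_mk, one_div,
    map_inv₀, map_natCast, div_eq_mul_inv]

/-- Dobiński's formula coefficientwise: `Σ_{j ≤ k} S(n, j)/(k − j)! = k^n/k!`.
[cite: RotaKahanerOdlyzko1973, §14, pp. 747–748] -/
theorem sum_stirlingSecond_div_factorial (n k : ℕ) :
    ∑ j ∈ range (k + 1), (n.stirlingSecond j : K) / ((k - j).factorial : K) = ((k : K) ^ n) / (k.factorial : K) := by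
  have h := congrArg (PowerSeries.coeff k) (exp_mul_touchardPolynomial K n)
  rw [PowerSeries.coeff_mk, PowerSeries.coeff_mul, Finset.Nat.sum_antidiagonal_eq_sum_range_succ_mk] at h
  rw [← h, ← sum_range_reflect]
  refine sum_congr rfl fun j hj => ?_
  have hjk : j ≤ k := Nat.lt_succ_iff.1 (mem_range.1 hj)
  dsimp only
  rw [show k + 1 - 1 - j = k - j by omega, Nat.sub_sub_self hjk, PowerSeries.coeff_exp,
    Polynomial.coeff_coe, coeff_touchardPolynomial, one_div, map_inv₀, map_natCast, div_eq_inv_mul]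

end Literature.Algebra.Polynomial
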